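import Summits.ABC.IUTFork.Joshi.ThetaJoshiAdelicPeriodBridge
import Summits.ABC.IUTFork.Joshi.LocalPeriodRingsSection
import HarnessLib

/-!
# Joshi, ATS III §6.7 over the §5 period rings WITHOUT a (5.2.5.4) witness: the adelic lift family realised on slot T-09's
# carriers with `B_E ↪ B̃_E` := the canonical section `secBE` (from the separability idempotent) — proof/bridge file

abc-iut cell, block E (rung LADDER-ABC:A2.E); seat abc-iut-E-t13 (gen 6), companion of abc-iut-E-t11's
`Joshi/ThetaJoshiAdelicPeriodBridge.lean` (§C `AdelicLiftDatum.ofPeriodRings A ℰ OE I e`: the [J-III] §6.5–§6.10 adelic lift family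
REALISED on slot T-09's `PeriodRingTower`/`BEDatum` carriers, whose field `toBtil` — (5.2.5.5) «`B_E ↪ B̃_E`» — is
`toBtilOfSplits (e w)` and therefore takes as INPUT a family `e` of WITNESSES of T-09's claim (5.2.5.4) `BtildeSplits` at every
place) and of this seat's `Joshi/LocalPeriodRingsSection.lean` (p446273: `BEDatum.secBE : B_E → B̃_E`, a section of the multiplication
map `B̃_E ↠ B_E`, injective UNCONDITIONALLY; `ℚ_p`-, `B`- and `E`-linear and multiplicative under Lemma 5.2.3.1 `BELinDisjoint`). Source:
K. Joshi, *Construction of Arithmetic Teichmüller Spaces III*, arXiv:2401.13508**v4** = [J-III] (UNREFEREED; bib `Joshi2024ATS3`;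
disputed by `Mochizuki2024JoshiReport`); locators = PDF page/line of the cell's render `HOME/lit/renders/Joshi-arxiv-2401.13508/`.
TAKES NO SIDE on [IUTchIII] Cor. 3.12, on Joshi's claims or on Mochizuki's report on them; typed ≠ proved ≠ endorsed. No `Prop` is
introduced, nothing of Joshi's is asserted, no `Cor312*`/`Thm311*` module is imported (E-PLAN R14), no instance / notation / axiom,
0 `sorry`; DEFS-FREEZE respected (p429036 / p430072 / p429989 / p433275 / E-t11's bridge imported BY NAME, nothing restated).

WHAT THIS FILE DOES.
* §1 `AdelicLiftDatum.ofPeriodRingsSec A ℰ OE I` — the SAME realisation as E-t11's `ofPeriodRings`, field for field, except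
  `toBtil w := (ℰ w).secBE` — so it takes NO (5.2.5.4) witness: the §6.7–§6.10 adelic family exists on the T-09 carriers for EVERY
  family of `p_w`-adic field data `ℰ`. `rfl` lemmas record the identifications; `ofPeriodRingsSec_toBtil_injective` —
  (5.2.5.5)/(6.9.1.2) «`B_E ↪ B̃_E`» is an EMBEDDING here (print's word; E-t11's signature does not even require it),
  unconditionally; `toBdR ∘`-compatibility `btildeToBdR (toBtil x) = x` (`ofPeriodRingsSec_btildeToBdR_toBtil`); and under Lemma
  5.2.3.1 at `w`, `toBtil w` is additive and multiplicative (`ofPeriodRingsSec_toBtil_add/_mul`).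
* §2 **[J-III] Thm. 6.7.1 for `ofPeriodRingsSec`** (`thm671_ofPeriodRingsSec`, `thm671_ofPeriodRingsSec_mulActionBE`): E-t11's
  `thm671_of_periodRings` applied to the witness-free family — Galois-, `φ`- and `Aut(G_{E′_w})`-stability of the basic theta-values
  locus at every `w ∈ V^{odd,ss}` MODULO EXACTLY E-t11's located residuals (continuity of `galBE g`, `φ_{B_E}^{±1}` for the chosen
  topology; scalars `O_{E′_w} → B_{E′_w}` landing in `E′_w`; `[G_{E′_w}, φ_{B_E}] = 0`) and NOTHING about (5.2.5.4).
READING NOTE (located, not adjudicated): `secBE` is the inclusion of ONE ideal factor `ε_B·B̃_E ≅ B_E` (p446273 `range_secBE`), not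
print's «diagonal» of (5.2.5.5); the §6.9 locus `Θ̃^{B̃_{L′}}` (p430072 `thetaLocusBLtil`) is the image under whichever embedding the
datum carries — here the section. bears_on: LADDER-ABC:A2.E.
-/

noncomputable section

open Set

namespace Summit.ABC.IUTFork.Joshi.ATS3

namespace AdelicLiftDatum

section PeriodRingsSec

variable (A : CollationDatum)
variable {F B₀ E₀ : A.V → Type} [∀ w, Field (F w)] [∀ w, CommRing (B₀ w)] [∀ w, Field (E₀ w)] {Y₀ : A.V → Type}
  {K₀ : ∀ w : A.V, Y₀ w → Type} [∀ (w : A.V) (y : Y₀ w), Field (K₀ w y)] {G₀ : A.V → Type} [∀ w, Group (G₀ w)]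
  {D : ∀ w : A.V, PeriodRingDatum (F w) (B₀ w) (E₀ w) (Y₀ w) (K₀ w) (G₀ w)} {p : A.V → ℕ} [∀ w, Fact (p w).Prime]
  [∀ w, Algebra ℚ_[p w] (B₀ w)] {Ω : A.V → Type} [∀ w, Field (Ω w)] [∀ w, Algebra ℚ_[p w] (Ω w)]
  {T : ∀ w : A.V, PeriodRingTower (D w) (p w) (Ω w)} (ℰ : ∀ w : A.V, (T w).BEDatum)
  (OE : A.V → Type) [∀ w, CommRing (OE w)] [∀ w, Algebra (OE w) ((T w).BE (ℰ w).E)]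
  [∀ w, TopologicalSpace ((T w).BE (ℰ w).E)]

/-! ## §1 The adelic lift family on the T-09 carriers, `B_E ↪ B̃_E` := the section `secBE` (no (5.2.5.4) witness) -/

/-- **The adelic family of lift data REALISED on slot T-09's carriers, witness-free**: field for field E-t11's `ofPeriodRings`
(`G := G_{E′_w}`, `galAct`, `frob := φ_{B_E}`, `AutG := Aut(G_{E′_w})`, `twist := twistBE`, `conv := convBE`, `BdR := Ω_w`, the §6.4
lift data and §6.10.2 descent data from the input `I`), EXCEPT `Btil := B ⊗_{ℚ_p} E′_w` with **`toBtil := secBE`** (p446273) — the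
canonical section of `B̃_E ↠ B_E`, defined for every `ℰ w` with no (5.2.5.4) `BtildeSplits` witness. [claim: Joshi2024ATS3, status: disputed] -/
def ofPeriodRingsSec (I : LiftInput A OE (fun w => (T w).BE (ℰ w).E)) :
    AdelicLiftDatum A OE (fun w => (T w).BE (ℰ w).E) where
  lift := I.lift
  oneFlat := I.oneFlat
  teich_oneFlat := I.teich_oneFlat
  absFlat_oneFlat := I.absFlat_oneFlat
  absK_zero := I.absK_zero
  absK_xi_pos := I.absK_xi_pos
  G w := (ℰ w).GE
  galAct w g := (ℰ w).galAct g
  frob w := (ℰ w).frobRingEquiv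
  AutG w := MulAut (ℰ w).GE
  autId _ := 1
  twist w σ S := (ℰ w).twistBE A.lstar σ S
  subset_twist_autId w S := (ℰ w).subset_twistBE A.lstar 1 S
  conv w := (ℰ w).convBE (OE w) A.lstar
  BdR w := Ω w
  toBdR w x := (x : Ω w)
  toBdR_injective w := (ℰ w).val_injective_BE
  Btil w := (ℰ w).Btilde
  toBtil w x := (ℰ w).secBE x
  Vmod := I.Vmod
  sel := I.sel
  sel_injective := I.sel_injective
  Bmod := I.Bmod
  trace := I.trace

variable (I : LiftInput A OE (fun w => (T w).BE (ℰ w).E))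

/-- The lift data of the witness-free family are the input `I.lift`. [folklore] -/
theorem ofPeriodRingsSec_lift (w : A.V) : (ofPeriodRingsSec A ℰ OE I).lift w = I.lift w := rfl

/-- Its Galois action is T-09's `galAct`. [folklore] -/
theorem ofPeriodRingsSec_galAct (w : A.V) (g : (ℰ w).GE) :
    (ofPeriodRingsSec A ℰ OE I).galAct w g = (ℰ w).galAct g := rfl

/-- Its Frobenius is T-09's `φ_{B_E}`. [folklore] -/
theorem ofPeriodRingsSec_frob (w : A.V) : (ofPeriodRingsSec A ℰ OE I).frob w = (ℰ w).frobRingEquiv := rfl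

/-- Its twists are the literal (5.3.1.2) twists, i.e. `G_{E′_w}`-saturations (as for E-t11's family). [folklore] -/
theorem ofPeriodRingsSec_twist (w : A.V) (σ : MulAut (ℰ w).GE) (S : Set (Fin A.lstar → (T w).BE (ℰ w).E)) :
    (ofPeriodRingsSec A ℰ OE I).twist w σ S = letI := (ℰ w).mulActionBEPi A.lstar; saturation (ℰ w).GE S := by
  letI := (ℰ w).mulActionBEPi A.lstar
  change (ℰ w).twistBE A.lstar σ S = _
  unfold PeriodRingTower.BEDatum.twistBE
  exact twistImage_eq_saturation σ S

/-- Its closure operator is §5.3.3's closed convex hull. [folklore] -/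
theorem ofPeriodRingsSec_conv_apply (w : A.V) (S : Set (Fin A.lstar → (T w).BE (ℰ w).E)) :
    (ofPeriodRingsSec A ℰ OE I).conv w S = closedConvexHull (OE w) S := rfl

/-- Its `toBdR` is the inclusion `B_{E′_w} ⊂ Ω_w`. [folklore] -/
theorem ofPeriodRingsSec_toBdR (w : A.V) (x : (T w).BE (ℰ w).E) : (ofPeriodRingsSec A ℰ OE I).toBdR w x = (x : Ω w) := rfl

/-- Its `toBtil` is the section `secBE`. [folklore] -/
theorem ofPeriodRingsSec_toBtil (w : A.V) (x : (T w).BE (ℰ w).E) :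
    (ofPeriodRingsSec A ℰ OE I).toBtil w x = (ℰ w).secBE x := rfl

/-- The §6.9 locus used by the two families agree off `toBtil`: same `adelicRing`, same lifts — so p430072's `thetaLocusBE`,
`thetaLocusBL` coincide with E-t11's realised family for any witness `e`. [folklore] -/
theorem ofPeriodRingsSec_lift_eq_ofPeriodRings
    (e : ∀ w : A.V, (ℰ w).Btilde ≃ₐ[ℚ_[p w]] (Fin (ℰ w).f → (T w).BE (ℰ w).E)) (w : A.V) :
    (ofPeriodRingsSec A ℰ OE I).lift w = (ofPeriodRings A ℰ OE I e).lift w := rfl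

/-- **(5.2.5.5)/(6.9.1.2) «`B_E ↪ B̃_E`» IS an embedding for the witness-free family — unconditionally** (`secBE` is a section of
the multiplication map, p446273 `secBE_injective`). [folklore] -/
theorem ofPeriodRingsSec_toBtil_injective (w : A.V) : Function.Injective ((ofPeriodRingsSec A ℰ OE I).toBtil w) :=
  (ℰ w).secBE_injective

/-- `B̃_E ↠ B_E` (multiplication) after `toBtil` is the identity: `m (toBtil x) = x` in `B_dR`. [folklore] -/
theorem ofPeriodRingsSec_btildeToBdR_toBtil (w : A.V) (x : (T w).BE (ℰ w).E) :
    (ℰ w).btildeToBdR ((ofPeriodRingsSec A ℰ OE I).toBtil w x) = (ofPeriodRingsSec A ℰ OE I).toBdR w x :=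
  (ℰ w).btildeToBdR_secBE x

/-- Under Lemma 5.2.3.1 at `w`, `toBtil w` is additive. [folklore] -/
theorem ofPeriodRingsSec_toBtil_add (w : A.V) (h : (ℰ w).BELinDisjoint) (x y : (T w).BE (ℰ w).E) :
    (ofPeriodRingsSec A ℰ OE I).toBtil w (x + y) = (ℰ w).secBE x + (ℰ w).secBE y :=
  (ℰ w).secBE_add h x y

/-- Under Lemma 5.2.3.1 at `w`, `toBtil w` is multiplicative. [folklore] -/
theorem ofPeriodRingsSec_toBtil_mul (w : A.V) (h : (ℰ w).BELinDisjoint) (x y : (T w).BE (ℰ w).E) :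
    (ofPeriodRingsSec A ℰ OE I).toBtil w (x * y) = (ℰ w).secBE x * (ℰ w).secBE y :=
  (ℰ w).secBE_mul h x y

/-- Under Lemma 5.2.3.1 at `w`, `toBtil w` is `ℚ_p`-homogeneous. [folklore] -/
theorem ofPeriodRingsSec_toBtil_smul (w : A.V) (h : (ℰ w).BELinDisjoint) (c : ℚ_[p w]) (x : (T w).BE (ℰ w).E) :
    (ofPeriodRingsSec A ℰ OE I).toBtil w (c • x) = c • (ℰ w).secBE x :=
  (ℰ w).secBE_smul h c x

/-! ## §2 Theorem 6.7.1 for the witness-free family -/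

/-- **[J-III] Theorem 6.7.1 for the witness-free REALISED family `ofPeriodRingsSec`** (its Frobenius IS `φ_{B_E}`): Galois-, `φ`- and
`Aut(G_{E′_w})`-stability of the basic theta-values locus at every `w ∈ V^{odd,ss}`, modulo exactly E-t11's located residuals —
the group acting through `galBE` (`hsmul`), scalars in `E′_w` (`hO`), continuity of `galBE g`, `φ_{B_E}^{±1}` (`hcont`, `hφc`,
`hφc'`), `[G_{E′_w}, φ_{B_E}] = 0` (`hcomm`) — and NO (5.2.5.4) witness. [claim: Joshi2024ATS3, status: disputed] -/
theorem thm671_ofPeriodRingsSec [∀ w, MulAction (ℰ w).GE ((T w).BE (ℰ w).E)]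
    (hsmul : ∀ (w : A.V) (g : (ℰ w).GE) (x : (T w).BE (ℰ w).E), g • x = (ℰ w).galBE g x)
    (hO : ∀ (w : A.V) (c : OE w), ((algebraMap (OE w) ((T w).BE (ℰ w).E) c : (T w).BE (ℰ w).E) : Ω w) ∈ (ℰ w).E)
    (hcont : ∀ (w : A.V) (g : (ℰ w).GE), Continuous ((ℰ w).galBE g))
    (hφc : ∀ w : A.V, Continuous (ℰ w).frobBE) (hφc' : ∀ w : A.V, Continuous (ℰ w).frobBE.symm)
    (hcomm : ∀ (w : A.V) (g : (ℰ w).GE) (x : (T w).BE (ℰ w).E),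
      (ℰ w).galBE g ((ℰ w).frobBE x) = (ℰ w).frobBE ((ℰ w).galBE g x)) :
    (ofPeriodRingsSec A ℰ OE I).Thm671 (fun w => (ℰ w).GE) :=
  thm671_of_periodRings A ℰ OE (ofPeriodRingsSec A ℰ OE I) (fun _ => rfl) hsmul hO hcont hφc hφc' hcomm

/-- With the CANONICAL action `BEDatum.mulActionBE` (T-09) the hypothesis `hsmul` is `rfl`: **Thm. 6.7.1 for the witness-free
realised family modulo continuity, scalars in `E`, and `[G_E, φ] = 0` only.** [claim: Joshi2024ATS3, status: disputed] -/
theorem thm671_ofPeriodRingsSec_mulActionBE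
    (hO : ∀ (w : A.V) (c : OE w), ((algebraMap (OE w) ((T w).BE (ℰ w).E) c : (T w).BE (ℰ w).E) : Ω w) ∈ (ℰ w).E)
    (hcont : ∀ (w : A.V) (g : (ℰ w).GE), Continuous ((ℰ w).galBE g))
    (hφc : ∀ w : A.V, Continuous (ℰ w).frobBE) (hφc' : ∀ w : A.V, Continuous (ℰ w).frobBE.symm)
    (hcomm : ∀ (w : A.V) (g : (ℰ w).GE) (x : (T w).BE (ℰ w).E),
      (ℰ w).galBE g ((ℰ w).frobBE x) = (ℰ w).frobBE ((ℰ w).galBE g x)) :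
    letI : ∀ w, MulAction (ℰ w).GE ((T w).BE (ℰ w).E) := fun w => (ℰ w).mulActionBE
    (ofPeriodRingsSec A ℰ OE I).Thm671 (fun w => (ℰ w).GE) :=
  letI : ∀ w, MulAction (ℰ w).GE ((T w).BE (ℰ w).E) := fun w => (ℰ w).mulActionBE
  thm671_ofPeriodRingsSec A ℰ OE I (fun _ _ _ => rfl) hO hcont hφc hφc' hcomm

end PeriodRingsSec

end AdelicLiftDatum

end Summit.ABC.IUTFork.Joshi.ATS3

end
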